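import Summits.QuantumFields.BalabanUV.T4Continuum.Spine.NE2.TorusBlockAveragePlaquette
import Literature.MathematicalPhysics.QuantumFieldTheory.Balaban1983to89.B7Prop2Explicit
import Literature.MathematicalPhysics.QuantumFieldTheory.Balaban1983to89.B7Prop6Bound

/-!
# T⁴ programme, spine node NE2 (U1a) — F6 (ζ) on the route's carriers, file 4: THE SIZE OF THE AVERAGED FIELD — `‖V̄_c − 1‖ ≤ (e^{4θ} − 1) + ((1 + a)^L − 1)`
# (cell `pub-balaban-gaps`, seat ne2 gen 7; after `TorusBlockAveragePlaquette`)

The ENDs of this node display a SIZE letter `‖U − 1‖ ≤ α_U/L^i` at EVERY level of every tower.  For a COHERENT tower the levels are averages of the finest field, and the size of an average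
is controlled by the finest field's size AND plaquette letters: `V̄_c = e^{X_c}·V(c)` ((42)) with `V(c)` a product of `L` bond variables — FIRST order in the bond size, scale-covariant
(`(1 + a)^L − 1 ≈ L·a`) — and `X_c` an average of logarithms of LOOP variables `V(Γ_{c,x})V(c)⁻¹`, each within `2θ` of `1` by the plaquette letter (`B7Prop2Explicit.norm_Wcx_sub_one_le`,
`θ = 8(d+1)(d+4)L²α₀` — SECOND order in the lattice spacing).  THIS FILE proves the one-step size bound:
 * §1 (`ℤ^d`) `norm_hol_seg_sub_one_le` (`‖V(c) − 1‖ ≤ (1 + a)^L − 1`, `B7Prop6Bound.mul_sub_one_norm_le`), `norm_Xavg_le` (`‖X_c‖ ≤ 4θ`), **`norm_bavg_sub_one_le`**;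
 * §2 (torus) **`norm_bavgTor_sub_one_le`** — the same for `TorusBlockAveragePlaquette.bavgTor` through the periodic lift.
File 5 (`ComposedRemainderCoherentTowerSizes`) iterates it down a coherent tower: the per-level size letters follow from the finest level's size and plaquette letters.
HONEST FRAMING (T4-DAG p. 1).  Elementary estimates on [B7]'s (42) (tree objects `B7Prop1Explicit`/`B7Prop2Explicit`), transferred to MODEL carriers; `V` is DATA; NOT NE2; **NE2 (U1a) NOT PROVED**;
spine PROVED 0/9 unchanged; NOT continuum YM / infinite volume / mass gap / Clay.  No `sorry`.
-/

noncomputable section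

open scoped BigOperators

namespace Summit.QuantumFields.BalabanUV.T4Continuum.NE2.TorusBlockAverageSize

open Literature.MathematicalPhysics.QuantumFieldTheory.Balaban1983to89
open Literature.MathematicalPhysics.QuantumFieldTheory.Balaban1983to89.B7Prop1Explicit
  (Site e hol plaqWord seg Wcx Xavg bavg U1 mem_U1 boxVec expUnit hol_mem hol_seg_natCast_succ norm_avg_le norm_exp_sub_one_le_of_norm_le)
open Literature.MathematicalPhysics.QuantumFieldTheory.Balaban1983to89.B7Prop2Explicit (norm_Wcx_sub_one_le)
open Literature.MathematicalPhysics.QuantumFieldTheory.Balaban1983to89.B7Prop6Bound (mul_sub_one_norm_le)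
open Literature.MathematicalPhysics.QuantumFieldTheory.Balaban1983to89.MatrixLog (mlog norm_mlog_le_two_mul)
open Literature.MathematicalPhysics.QuantumFieldTheory.Balaban1983to89.B5Prop11Plancherel (Tor fine unitVec)
open Summit.QuantumFields.BalabanUV.T4Continuum.NE2.TorusBlockAveragePlaquette (liftCfg liftCfg_apply bavgTor tplaq hol_lift_plaqWord zrep)

variable {d : ℕ} {𝔸 : Type*} [NormedRing 𝔸] [NormOneClass 𝔸] [NormedAlgebra ℂ 𝔸] [CompleteSpace 𝔸]

/-! ## §1 The size of the average on `ℤ^d` -/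

omit [NormOneClass 𝔸] [NormedAlgebra ℂ 𝔸] [CompleteSpace 𝔸] in
/-- the straight contour: `‖V(c) − 1‖ ≤ (1 + a)^n − 1` for a product of `n` bond variables within `a` of `1`. [folklore] -/
theorem norm_hol_seg_sub_one_le {V : Site d → Fin d → 𝔸ˣ} {a : ℝ} (ha : 0 ≤ a) (hVa : ∀ x κ, ‖((V x κ : 𝔸ˣ) : 𝔸) - 1‖ ≤ a) (z : Site d) (κ : Fin d) :
    ∀ n : ℕ, ‖((hol V z (seg κ n) : 𝔸ˣ) : 𝔸) - 1‖ ≤ (1 + a) ^ n - 1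
  | 0 => by simp [seg]
  | n + 1 => by
      have ih := norm_hol_seg_sub_one_le ha hVa z κ n
      rw [show ((n + 1 : ℕ) : ℤ) = (n : ℤ) + 1 by push_cast; rfl, hol_seg_natCast_succ, Units.val_mul]
      refine (mul_sub_one_norm_le _ _).trans ?_
      have h1 : 0 ≤ 1 + ‖((V (z + (n : ℤ) • e κ) κ : 𝔸ˣ) : 𝔸) - 1‖ := by positivity
      have h2 : (0 : ℝ) ≤ (1 + a) ^ n := by positivity
      calc (1 + ‖((hol V z (seg κ n) : 𝔸ˣ) : 𝔸) - 1‖) * (1 + ‖((V (z + (n : ℤ) • e κ) κ : 𝔸ˣ) : 𝔸) - 1‖) - 1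
          ≤ (1 + a) ^ n * (1 + a) - 1 := by
            have := mul_le_mul (by linarith : 1 + ‖((hol V z (seg κ n) : 𝔸ˣ) : 𝔸) - 1‖ ≤ (1 + a) ^ n) (by linarith [hVa (z + (n : ℤ) • e κ) κ] : 1 + ‖((V (z + (n : ℤ) • e κ) κ : 𝔸ˣ) : 𝔸) - 1‖ ≤ 1 + a) h1 h2
            linarith
        _ = (1 + a) ^ (n + 1) - 1 := by rw [pow_succ]

variable (L : ℕ)

/-- the exponent of (42): `‖X_c‖ ≤ 4θ`, `θ = 8(d+1)(d+4)L²α₀` (each loop variable within `2θ ≤ 1/32` of `1`, (26) `|log X| ≤ 2|X − 1|`, convex combination). [cite: Balaban1985Averaging, (42) p.23, (26) p.22, p.25] [folklore] -/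
theorem norm_Xavg_le (hL : 1 ≤ L) (V : Site d → Fin d → 𝔸ˣ) (hV : ∀ x κ, V x κ ∈ U1 𝔸) {α₀ : ℝ} (hα₀ : 0 ≤ α₀)
    (hsmall : 512 * (d + 1) * (d + 4) * (L : ℝ) ^ 2 * α₀ ≤ 1)
    (h44 : ∀ (x : Site d) (κ κ' : Fin d), κ ≠ κ' → ‖((hol V x (plaqWord κ κ') : 𝔸ˣ) : 𝔸) - 1‖ ≤ α₀) (q : Site d) (κ : Fin d) :
    ‖Xavg L V q κ‖ ≤ 4 * (8 * (d + 1) * (d + 4) * (L : ℝ) ^ 2 * α₀) := by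
  unfold Xavg
  refine norm_avg_le L hL _ fun r => ?_
  have hW := norm_Wcx_sub_one_le L hL V hV hα₀ hsmall h44 q κ r
  have hd : (0 : ℝ) ≤ d := Nat.cast_nonneg d
  have hhalf : ‖((Wcx L V q κ (boxVec L r) : 𝔸ˣ) : 𝔸) - 1‖ ≤ 1 / 2 := hW.trans (by nlinarith)
  calc ‖mlog ((Wcx L V q κ (boxVec L r) : 𝔸ˣ) : 𝔸)‖ ≤ 2 * ‖((Wcx L V q κ (boxVec L r) : 𝔸ˣ) : 𝔸) - 1‖ := norm_mlog_le_two_mul hhalf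
    _ ≤ _ := by linarith

/-- **THE SIZE OF THE AVERAGE (42)**: bond variables within `a` of `1`, plaquettes within `α₀` (`512(d+1)(d+4)L²α₀ ≤ 1`) ⟹
`‖V̄_c − 1‖ ≤ (e^{4θ} − 1) + ((1 + a)^L − 1)` (`V̄_c = e^{X_c}V(c)`: `e^{X_c}V(c) − 1 = (e^{X_c} − 1)V(c) + (V(c) − 1)`, `|V(c)| ≤ 1`). [cite: Balaban1985Averaging, (42) p.23] [folklore] -/
theorem norm_bavg_sub_one_le (hL : 1 ≤ L) (V : Site d → Fin d → 𝔸ˣ) (hV : ∀ x κ, V x κ ∈ U1 𝔸) {α₀ a : ℝ} (hα₀ : 0 ≤ α₀) (ha : 0 ≤ a)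
    (hsmall : 512 * (d + 1) * (d + 4) * (L : ℝ) ^ 2 * α₀ ≤ 1)
    (h44 : ∀ (x : Site d) (κ κ' : Fin d), κ ≠ κ' → ‖((hol V x (plaqWord κ κ') : 𝔸ˣ) : 𝔸) - 1‖ ≤ α₀) (hVa : ∀ x κ, ‖((V x κ : 𝔸ˣ) : 𝔸) - 1‖ ≤ a)
    (q : Site d) (κ : Fin d) :
    ‖((bavg L V q κ : 𝔸ˣ) : 𝔸) - 1‖ ≤ (Real.exp (4 * (8 * (d + 1) * (d + 4) * (L : ℝ) ^ 2 * α₀)) - 1) + ((1 + a) ^ L - 1) := by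
  have hX := (norm_exp_sub_one_le_of_norm_le (norm_Xavg_le L hL V hV hα₀ hsmall h44 q κ)).1
  have hh : ‖((hol V q (seg κ L) : 𝔸ˣ) : 𝔸)‖ ≤ 1 := (mem_U1.mp (hol_mem hV q (seg κ L))).1
  have hh1 := norm_hol_seg_sub_one_le ha hVa q κ L
  have e1 : ((bavg L V q κ : 𝔸ˣ) : 𝔸) - 1
      = (NormedSpace.exp (Xavg L V q κ) - 1) * ((hol V q (seg κ L) : 𝔸ˣ) : 𝔸) + (((hol V q (seg κ L) : 𝔸ˣ) : 𝔸) - 1) := by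
    show NormedSpace.exp (Xavg L V q κ) * ((hol V q (seg κ L) : 𝔸ˣ) : 𝔸) - 1 = _
    noncomm_ring
  rw [e1]
  calc ‖(NormedSpace.exp (Xavg L V q κ) - 1) * ((hol V q (seg κ L) : 𝔸ˣ) : 𝔸) + (((hol V q (seg κ L) : 𝔸ˣ) : 𝔸) - 1)‖
      ≤ ‖NormedSpace.exp (Xavg L V q κ) - 1‖ * ‖((hol V q (seg κ L) : 𝔸ˣ) : 𝔸)‖ + ‖((hol V q (seg κ L) : 𝔸ˣ) : 𝔸) - 1‖ := (norm_add_le _ _).trans (by gcongr; exact norm_mul_le _ _)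
    _ ≤ (Real.exp (4 * (8 * (d + 1) * (d + 4) * (L : ℝ) ^ 2 * α₀)) - 1) * 1 + ((1 + a) ^ L - 1) := by
        gcongr
        · exact sub_nonneg.mpr (Real.one_le_exp (by have hd : (0 : ℝ) ≤ d := Nat.cast_nonneg d; positivity))
    _ = _ := by rw [mul_one]

/-! ## §2 The size of the torus average -/

variable (N : ℕ) [NeZero N] [NeZero L] (M : Fin d → ℕ) [hM : ∀ μ, NeZero (M μ)]

omit [NeZero N] [NeZero L] hM in
/-- **THE SIZE OF THE TORUS AVERAGE**: `norm_bavg_sub_one_le` for `bavgTor` through the periodic lift. [cite: Balaban1985Averaging, (42) p.23] [folklore] -/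
theorem norm_bavgTor_sub_one_le (hL : 1 ≤ L) (V : Tor (fine (L * N) M) → Fin d → 𝔸ˣ) (hV : ∀ y κ, V y κ ∈ U1 𝔸) {α₀ a : ℝ} (hα₀ : 0 ≤ α₀) (ha : 0 ≤ a)
    (hsmall : 512 * (d + 1) * (d + 4) * (L : ℝ) ^ 2 * α₀ ≤ 1)
    (h44 : ∀ (y : Tor (fine (L * N) M)) (κ κ' : Fin d), κ ≠ κ' → ‖((tplaq V y κ κ' : 𝔸ˣ) : 𝔸) - 1‖ ≤ α₀) (hVa : ∀ y κ, ‖((V y κ : 𝔸ˣ) : 𝔸) - 1‖ ≤ a)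
    (y : Tor (fine N M)) (κ : Fin d) :
    ‖((bavgTor N L M V y κ : 𝔸ˣ) : 𝔸) - 1‖ ≤ (Real.exp (4 * (8 * (d + 1) * (d + 4) * (L : ℝ) ^ 2 * α₀)) - 1) + ((1 + a) ^ L - 1) := by
  unfold bavgTor
  exact norm_bavg_sub_one_le L hL (liftCfg V) (fun x κ => hV _ κ) hα₀ ha hsmall (fun x κ κ' hκ => by rw [hol_lift_plaqWord]; exact h44 _ κ κ' hκ)
    (fun x κ => hVa _ κ) (zrep N L M y) κ

end Summit.QuantumFields.BalabanUV.T4Continuum.NE2.TorusBlockAverageSize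

end
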